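import Summits.BirchSwinnertonDyer.BirchSwinnertonDyer.Theses.KatoDescentPotSupersingular
import Summits.BirchSwinnertonDyer.Rank1Residual.O6.X3KatoMemberBoundReadingsTight
import HarnessLib

/-!
# Route `KatoDescentPotSupersingular` (K9; shared with `KatoDescentTamePotSupersingular`, K8-t′): crux
# `ReducibleKatoMember` (item stmt-BirchSwinnertonDyer-19196) — TIGHTNESS of the hull-reading road,
# route-typed restatement (cell `bsd-potss`, seat `bsd-potss-rkm` generation 2; `--supports` helper)

HONEST FRAMING. The crux M = `ReducibleKatoMember` (:= cell `b2b-bsdres`'s node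
`O6.KatoMemberShaBoundOfReducible`, T-X3K) is NOT closed by this file and BSD is not advanced by it.
The tree proves M from kmc's three HYPOTHESIS SCHEMATA M1 `KatoHull.MemberRealizable`, M2
`KatoHull.DivisibilityReading`, M3 `KatoHull.CountReading` over a FREE interface predicate `IsHullOf`
(part 12, `O6.katoMemberShaBoundOfReducible_of_hullReadings`; route-typed in
`Theorems/KatoDescentPotSupersingularReducibleKatoMember.lean`, p414320). The sibling Summits file
`Rank1Residual/O6/X3KatoMemberBoundReadingsTight.lean` (this seat) proves the CONVERSE with the trivial
`KatoHullDescentDatum` and the tautological predicate, whence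
`O6.KatoMemberShaBoundOfReducible.iff_exists_hullReadings`. This file restates that equivalence with the
ROUTE DECL on the left: existentially closed over the free predicate, the three readings carry EXACTLY
the content of the crux — they can settle the item by citation only once `IsHullOf` is PINNED to Kato's
objects (`𝐇¹_Γ(T_pW)⁰` = `Kato2004.IwasawaH1Data`, `H¹(ℤ[1/p],T_pW)` = `Kato2004.integralH1`, the zeta
class through its values = `Kato2004.exists_member_eulerSystem_expStar_values` (p425804) + a κ-layer
bridge, and `𝐇²(T_pW)⁰`), i.e. the definition item D-O6-2; seat note REALISATION-SPEC v3 (item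
evidence). The K8-t′ alias `Theses.KatoDescentTamePotSupersingular.ReducibleKatoMember` has the same
body, so the statement transfers verbatim.

References: K. Kato, Astérisque 295 (2004) Thm. 12.4–12.6, 13.14, §14.14–14.16 [Kato2004Asterisque];
C. Wuthrich, Doc. Math. 19 (2014) §3.2, Lemma 11, 12, 14 [Wuthrich2014] — the printed inputs the
readings transcribe; nothing about them is proved here.
-/

set_option autoImplicit false
-- sibling precedent (`KatoDescentPotSupersingularAssembly.lean`): the directory name repeats the summit name
set_option linter.dupNamespace false

noncomputable section

namespace Summit.BirchSwinnertonDyer.BirchSwinnertonDyer.Theorems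

open Summit.BirchSwinnertonDyer.Rank1Residual Summit.BirchSwinnertonDyer.Rank1Residual.Additive

/-- **TIGHTNESS of the hull-reading road for the crux `ReducibleKatoMember`** (item
stmt-BirchSwinnertonDyer-19196; left-hand side = the route decl verbatim): the crux holds IF AND ONLY IF
there is SOME interface predicate `IsHullOf` over which kmc's three hull readings hold — `⟸` kmc part
12, `⟹` the trivial datum + tautological predicate (`O6.KatoMemberShaBoundOfReducible.iff_exists_hullReadings`).
So the un-pinned readings are not a citation-level input: entering them as a cite-only support would be
entering the crux itself. [folklore] -/
theorem ReducibleKatoMember.reducibleKatoMember_iff_exists_hullReadings :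
    Summit.BirchSwinnertonDyer.BirchSwinnertonDyer.Theses.KatoDescentPotSupersingular.ReducibleKatoMember ↔
      ∃ IsHullOf : (∀ (W : WeierstrassCurve ℚ) [W.IsElliptic] [W.IsGloballyMinimal] (p : ℕ)
          [Fact p.Prime], KatoHullDescentDatum p → Prop),
        KatoHull.MemberRealizable IsHullOf ∧ KatoHull.DivisibilityReading IsHullOf ∧
          KatoHull.CountReading IsHullOf :=
  O6.KatoMemberShaBoundOfReducible.iff_exists_hullReadings

/-- The `⟹` half alone, route-typed: from the crux, SOME predicate realises all three readings.
[folklore] -/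
theorem ReducibleKatoMember.exists_hullReadings_of_reducibleKatoMember
    (h : Summit.BirchSwinnertonDyer.BirchSwinnertonDyer.Theses.KatoDescentPotSupersingular.ReducibleKatoMember) :
    ∃ IsHullOf : (∀ (W : WeierstrassCurve ℚ) [W.IsElliptic] [W.IsGloballyMinimal] (p : ℕ)
        [Fact p.Prime], KatoHullDescentDatum p → Prop),
      KatoHull.MemberRealizable IsHullOf ∧ KatoHull.DivisibilityReading IsHullOf ∧
        KatoHull.CountReading IsHullOf :=
  O6.KatoMemberShaBoundOfReducible.exists_hullReadings_of h

end Summit.BirchSwinnertonDyer.BirchSwinnertonDyer.Theorems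

end
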